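import Mathlib
import HarnessLib
import HarnessLib.Audit
import Summits.AtomisticToContinuum.Statement

/-!
Route: ChapmanEnskogCorrector

CLOSED (retired) 2026-08-15T13:41:17Z by operator:999:1257524 — reason: not-a-thesis: assembly does not conclude the sub-problem Statement — note: D-0027 §2.1 audit (human 2026-08-15: routes that do not decide the summit are removed): the assembly concludes `Literature.MathematicalPhysics.KineticTheory.HydrodynamicLimit`, not the sub-problem statement; a NEW conforming route may be opened from the same idea (generated `closes : … → _root_.Hydr. The file is kept as the record of this route; refuted decls are indexed as negative knowledge (`ledger negatives`).

X_CE (CHAPMAN–ENSKOG TEST FUNCTIONS FOR THE FIRST BBGKY EQUATION; realises idea card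
chapman-enskog-corrector; it suffices to show):
along the deterministic hard-sphere evolution on 𝕋³ at fixed small reduced density σ³, started from
a local Gibbs law and
compared with the classical hs-Euler solution (ρ,u,θ) on [0,T), for every t < T:
 (C1) ENSKOG TRANSFER IN THE MEAN — the expected total collisional change over [0,t] of any one-body
observable
      Σ_i [c(s,x_i)·v_i + c₄(s,x_i)|v_i|²] (smooth coefficients; computed trace-free as
      E[Σφ(t)] − E[Σφ(0)] − ∫E[Σ(∂_s+v·∇ₓ)φ]) equals asymptotically its ENSKOG value: the BBGKY
collision operator
      C^N_{1,2} (Kinetic.bbgkyCollisionOp, rate Nε² = σ²N^{1/3}) applied to the closure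
Y(ρ_sσ³)·F¹_N(s)⊗F¹_N(s) of the
      one-body marginal F¹_N(s) of the time-s law, Y = (Z−1)/((2π/3)η) the contact value, tested
against φ;
 (C2) LOCAL MAXWELLIANITY IN THE MEAN — the time-integrated Enskog collision term of F¹_N(s)
(Kinetic.hsCollisionTerm of
      the same closure, no rate prefactor) vanishes weakly against every continuous weight of
quadratic velocity growth;
 (C3) CONTACT BILINEAR ENTROPY BOUND — the σ³-weighted contact L¹-functional of (F¹_N(s) −
M_s)⊗(F¹_N(s) − M_s)
      (M_s = ρ_s × local Maxwellian of (u_s,θ_s); weight (1+|v₁|²+|v|²)|v−v₁|; partner at x + ε_N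
ω), integrated over
      [0,t], is ≤ C·∫_0^t klDiv(law_s ‖ local Gibbs(a_s,u_s,θ_s))/(N+1) ds + o(1) for every
continuous activity a;
 (C4) CUBIC MOMENTS IN THE MEAN — sup_{s≤t,N≥N₀} E[(N+1)⁻¹Σ_i |v_i(s)|³] < ∞.
Then (glue CorrectedEntropyGronwall) the specific relative entropy w.r.t. the Euler-driven local
Gibbs state vanishes,
i.e. the shared typed target RelEntropyVanishing (= stmt-AtomisticToContinuum-0766 of
RelEntropyErgodic/ChaoticMixing/
VanishingNoise), and RelEntropyVanishing → HydrodynamicLimit by the entropy inequality (=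
stmt-0769).

Lean: EnskogTransferInMean → LocalMaxwellianInMean → ContactBilinearEntropyBound →
CubicMomentsInMean → RelEntropyVanishing
(decls of this route file, each a closed Prop over
Literature.MathematicalPhysics.KineticTheory.{localGibbsLaw, hsDiameter,
IsHardSphereEulerSolution, TendstoHydroFieldsAt, hsCompressibility, sphereMeasure} and
Literature.Analysis.FluidPDE.{HardSphereFlow,
hsTransport, canonicalDensity, nthMarginal, bbgkyCollisionOp, hsCollisionTerm, empiricalMeasure,
localMaxwellian};
Sketch.lean elaborates, lean check rc 0).

## Assembly
Assembly := EnskogTransferInMean → LocalMaxwellianInMean → ContactBilinearEntropyBound →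
CubicMomentsInMean →
Literature.MathematicalPhysics.KineticTheory.HydrodynamicLimit, proved as EntropyInequalityStep ∘
CorrectedEntropyGronwall.
MECHANISM OF THE GLUE (the card's corrector, made precise): H(f_t|ψ_t) − H(f_0|ψ_0) =
−(N+1)[Jump_N[ℓ](t) + ∫∫(∂_s+v·∇)ℓ F¹]
+ log(𝒵_t/𝒵_0) EXACTLY, where ℓ_s = log a_s + log M_{u_s,θ_s} is a collision-invariant weight (class
of C1) and Jump_N the
trace-free collision functional; C1 replaces Jump_N[ℓ] by its Enskog value; the kinetic current term
∫∇λ·j F¹ is split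
ALGEBRAICALLY (pointwise in x) into mean + slow + fast parts: the slow part cancels against ∂_sλ by
the Euler equations in
entropy variables (with p = ρθZ from the Enskog transfer term, virial identity), the fast part
⟨P_fast(∇λ·j), F¹−M⟩ is
rewritten with the Chapman–Enskog test function ĝ = 𝓛♭⁻¹P_fast(∇λ·j) (𝓛♭ = linearised hard-sphere
operator at M_s(x),
invertible on the fast subspace: Grad/Baranger–Mouhot gap,
Literature.Analysis.UnboundedOperators.LinearizedBoltzmann) as
ρ²Y⟨ĝ, 𝓛♭h⟩ = Y⟨ĝ, Q(F¹,F¹)⟩ − Y⟨ĝ, Q(Mh,Mh)⟩: the first term → 0 in time integral by C2 (this IS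
"the fast current is a
collisional time derivative up to o(1)": Y⟨ĝ,Q(F¹,F¹)⟩ = N^{-1/3}·(rate-normalised first BBGKY
equation tested with ĝ) under
molecular chaos), the second is a bilinear contact functional bounded through C3; the remaining
O(Kn) streaming terms of
ĝ need C4. Gronwall on H/(N+1) with o(1) forcing gives RelEntropyVanishing (reference concentration:
LocalGibbsConcentration;
smooth EOS: HsEosLowDensity; jointly measurable flows wlog by HardSphereFlow.flow_eq_ae).

Rationale: WHY THIS LINE. Yau's relative entropy method (Yau1991; OllaVaradhanYau1993 Thm 1.1 with weak noise)
needs ONE dynamical input for the kinetic currents — a one-block/ergodic theorem (route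
RelEntropyErgodic's GibbsErgodicity 0779, ChaoticMixing's UniformLocalMixing 0830, VanishingNoise's
noise) — plus, for hard spheres, control of the collisional-transfer current, which is a
CONTACT-boundary flux. The card chapman-enskog-corrector observes that the fast (non-hydrodynamic)
part of the kinetic current is, up to o(1), a collisional time derivative: testing the first BBGKY
equation with the Chapman–Enskog function ĝ = 𝓛♭⁻¹(fast driving) (kinetic theory import:
CIPDiluteGases1994 §7, BarangerMouhot2005, Grad1963; hypocoercive "corrected entropy" idea of
Villani2009; kinetic-level correctors SaintRaymondAIHP2009) converts it into boundary terms + a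
bilinear contact term, so that NO block averaging, NO infinite-volume dynamics and NO
large-deviation step on the cubic energy current is ever used. Making the card's bookkeeping precise
at the typed level shows exactly what it consumes: Enskog collisional transfer in the mean (C1:
two-body, carries the hard-sphere EOS p = ρθZ via Y = contact value, VanbeijerenErnst1973,
Resibois1978), weak time-averaged local Maxwellianity of the one-body marginal (C2), an entropy
bound for bilinear contact functionals of F¹ − M (C3) and MEAN cubic velocity moments (C4). All four
are finite-N, trace-free, junk-safe statements about the true evolution that elaborate today
(Sketch.lean rc 0); the glue and the entropy-inequality step are typed implications.
RANKED CRUXES. #2 EnskogTransferInMean — expected collisional change of Σ[c·v+c₄|v|²](s,x_i) over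
[0,t] (= E[Σφ(t)]−E[Σφ(0)]−∫E[Σ(∂_s+v·∇)φ]) minus ∫_0^t∫φ·bbgkyCollisionOp(Y(ρ_sσ³)F¹⊗F¹) → 0 (why
it might fail: pre-collisional contact correlations at fixed φ — ring events, Cohen1967 §4c-d,
Dorfman1999 §16; Enskog not derivable from Liouville, Soto2016 p122; in equilibrium it is the virial
theorem). #3 LocalMaxwellianInMean — ∫_0^t∫φ·hsCollisionTerm(Y F¹⊗F¹) → 0 for continuous φ, |φ| ≤
1+|v|² (why it might fail: it is propagation of local equilibrium in weak one-body form, the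
Boltzmann-hypothesis input, OllaVaradhanYau1993 §1 p525, Spohn1991 I.3). #4
ContactBilinearEntropyBound — σ³∫∫∫∫(1+|v₁|²+|v|²)|v−v₁||δF(x,v₁)||δF(x+ε_Nω,v)| ≤
C∫klDiv(law_s‖localGibbs(a_s,u_s,θ_s))/(N+1) + o(1), δF = F¹_N(s) − ρ_sM_{u_s,θ_s} (why it might
fail: false for general finite-entropy laws — prescribed near-contact placements are entropically
cheap — so it needs ε-scale spatial regularity of F¹ created by the dynamics; SaintRaymond2009
§6.2.1 p152 names the missing L∞_x bound even for Boltzmann). #5 CubicMomentsInMean — sup_{s≤t}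
E[(N+1)⁻¹Σ|v_i(s)|³] ≤ C for N ≥ N₀ (why it might fail: energy conservation and entropy w.r.t. the
invariant Gibbs state control nothing above |v|²; a fraction N^{-a} of particles at speed N^{a/2} is
admissible; OllaVaradhanYau1993 §1).
KILL CRITERIA. ¬EnskogTransferInMean at some fixed σ < σ₀ before the shock (e.g. a persistent O(1)
defect of collisional momentum transfer vs Y·F¹⊗F¹ in a smooth shear/compression, from ring
resummation or MD) closes the route and refutes the Enskog contact structure shared in substance
with DenseKineticExpansion's 0805. ¬LocalMaxwellianInMean closes this route AND the premise of every
relative-entropy route (0766 would still stand formally). ¬ContactBilinearEntropyBound alone forces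
the pivot to OneBodyGaussianBound (support) as an explicit extra crux. ¬RelEntropyVanishing (0766)
closes routes RelEntropyErgodic, ChaoticMixing, VanishingNoise and this one.
NOT DECOMPOSED YET. (i) The card's barrier-evading refinement of #3: replace weak local
Maxwellianity by a RESUMMED LINEAR CONTACT RESPONSE (molecular chaos at incoming contact up to an
O(φ)-bounded, slow-blind, s-smooth linear operator K[F¹−M] and entropy-controlled quadratic errors),
after which local equilibration is OUTPUT of the Gronwall via the Neumann series in σ³ — not
typeable safely today (an ∃ over operators is cheatable by rank-one K built from the defect); it
becomes the split LocalMaxwellianInMean ⇐ ResummedContactResponse + bootstrap glue once the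
definition request below lands. (ii) The glue's internal lemmas (exact entropy identity along
HardSphereFlow via the trace-free jump functional; Euler-in-entropy-variables cancellation of slow
linear terms with p = ρθZ; LD rate of the one-body empirical measure under the hard-core local Gibbs
law ≥ (1−Cσ³)·relative entropy; wlog jointly measurable flow) ride as --supports lemmas, never
items. (iii) d = 3, pre-shock, and implicitly pre-freezing: the cruxes inherit the conjunct's
exposure to imploding Euler data (card implosion-loophole), no better and no worse.
CHEAPEST FALSIFIER. Equilibrium case of #2: for the GLOBAL Gibbs state (constant profiles)
Jump_N[c(x)·v] is the collisional momentum flux and #2 reduces to the hard-sphere virial theorem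
p/ρθ = 1 + (2π/3)ρσ³ g(σ⁺) with g(σ⁺) = Y(ρσ³) := (hsCompressibility − 1)/((2π/3)η) in the canonical
thermodynamic limit — a one-page check of normalisations (rate Nε², factor ½ from pair symmetry,
sign of (ω·(v−v₁))₋) that a refuter can do by hand or by MD at φ = 0.05; any mismatch of constants
kills the typed #2 as stated (and is repairable by restating).
TWO-LAYER PLAN. Layer 1 = the four cruxes + target RelEntropyVanishing (0766, shared) + Assembly.
Layer 2 (only after a crux closes or stalls with a census): #3 ⇐ ResummedContactResponse →
BootstrapGlue → LocalMaxwellianInMean (k = 2); #4 ⇐ OneBodyGaussianBound → MarginalLDRate →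
ContactBilinearEntropyBound (k = 2; OneBodyGaussianBound already filed as support, and
OneBodyGaussianBoundGivesMoments : OneBodyGaussianBound → CubicMomentsInMean).
SOURCES. Yau1991; OllaVaradhanYau1993 §1, Thm 1.1; Spohn1991 Part I Ch. 3; KipnisLandim1999 Ch. 6–7;
SaintRaymond2009 (LNM 1971) §6.2.1 p152 (read: "the difficulty will be to control the energy flux —
a moment of third order — … requires an L∞ bound with respect to the spatial variables");
SaintRaymondAIHP2009 (doi:10.1016/j.anihpc.2008.01.001, correctors in the relative entropy method at
kinetic level); CIPDiluteGases1994 §4.3 (BBGKY weak form), §7 (𝓛, Chapman–Enskog); GST2013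
(4.3.5)–(4.3.7); BarangerMouhot2005 Thm 1.1; Grad1963; VanbeijerenErnst1973; Resibois1978; Cohen1967
§4; Dorfman1999 §16; Soto2016 p122; Villani2009; arXiv:1310.0406; LebowitzPenrose1964; Ruelle1969
§3.4.
DEFINITION REQUESTS. LinearizedEnskogOperator (topic Literature/MathematicalPhysics/KineticTheory):
the linearised revised-Enskog collision operator at a local Maxwellian M_{ρ,u,θ} with contact factor
Y(ρσ³) and spatial shifts ±εω, its restriction 𝓛♭ (ε = 0: Y·ρ·hardSphereLinearizedOp rescaled to
(u,θ)) and the Chapman–Enskog inverse 𝓛♭⁻¹ on the M-orthogonal complement of collisionInvariants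
with polynomial-growth bounds — needed to type ĝ explicitly (turning #3 into a statement about two
named test functions) and to type the resummed contact response operator of NOT DECOMPOSED YET (i).
SUPPORT. RelEntropyVanishing (target, = 0766), EntropyInequalityStep (= 0769: entropy inequality +
exponential concentration), LocalGibbsConcentration (= 0767), HsEosLowDensity (= 0768),
CorrectedEntropyGronwall (the glue: C1 → C2 → C3 → C4 → RelEntropyVanishing), OneBodyGaussianBound
(a.e. Gaussian upper bound K e^{−c|v|²} on F¹_N(s), N ≥ N₀, s ≤ t: sufficient for C4 and, with the
marginal LD rate, for C3), OneBodyGaussianBoundGivesMoments.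
DEGENERATE CASES CHECKED. Ideal gas (no collisions): hsCollisionTerm ≡ 0 makes #3 vacuous-true but
#2's Jump ≡ Ens ≡ 0 too and the glue has no 𝓛♭ to invert — the route correctly says nothing
(BoltzmannHypothesisBarrier's kernel). Junk audit: no trace of the true two-body marginal on the
contact set is ever taken (flow junk off the good set would make it arbitrary); closure functionals
of F¹ are a.e.-robust; all one-sided quantities are lintegrals/NNReal constants (klDiv = ⊤ or
non-integrability can only weaken, never falsify); time integrals carry the hypothesis of a jointly
measurable flow; Y(0) := 1 and ρ_sσ³ stays in the analytic range of HsEosLowDensity for σ <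
σ₀(profiles) at s = 0 (initial LLN ties ρ(0) to a₀).

Novelty: NOVELTY (searched 2026-08-15: lit search --hybrid "relative entropy method hydrodynamic limit hard
spheres Enskog collisional transfer local equilibrium" (8 held docs: KipnisLandim1999,
CIPDiluteGases1994, SaintRaymond2009, de Masi–Presutti 1991, Soto2016 …), lit search --hybrid
"Saint-Raymond … improvements of the relative entropy method correctors", lit read SaintRaymond2009
pp 152–153 (§6.2.1–6.2.2) and p117 (modulated entropy with flux correctors Φ, Ψ), lit cite
doi:10.1016/j.anihpc.2008.01.001 (added as SaintRaymondAIHP2009); remote cascade and lit galaxy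
search --star all were unavailable (rc error / 0 rows queued) at 11:30Z; the card's own searches and
the triage's prior list are inherited: KipnisLandim1999 Ch. 7 pp 184–190, Funaki–Uchiyama–Yau 1996,
Esposito–Marra JSP 74 (1994) 981, arXiv:1310.0406, Yau1991, OllaVaradhanYau1993).
Nearest prior art FOUND: (1) SaintRaymondAIHP2009 / SaintRaymond2009 §5.1.3 p117: correctors
(acoustic/Knudsen components, flux test functions Φ = traceless v⊗v, Ψ = ½v(|v|²−5)) inside the
modulated entropy — at the KINETIC level (Boltzmann → incompressible Euler/NS), where 𝓛⁻¹Φ, 𝓛⁻¹Ψ are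
tested against the Boltzmann equation itself; (2) OllaVaradhanYau1993 Thm 1.1 + Yau1991: the N-body
relative entropy architecture with one-block/ergodic closure (noise); (3) KipnisLandim1999 Ch. 7
(non-gradient method: currents = gradient + L(local function), diffusive, needs a symmetric part);
(4) VanbeijerenErnst1973/Resibois1978: Enskog contact closure Y·  [refs: 10.1016/j.anihpc.2008.01.001, 1310.0406, doi:10.1016/j.anihpc.2008.01.001, KipnisLandim1999, CIPDiluteGases1994, SaintRaymond2009, Soto2016, SaintRaymondAIHP2009, Yau1991, OllaVaradhanYau1993, VanbeijerenErnst1973, Resibois1978]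

Barriers (technique_class: relative-entropy corrector chapman-enskog contact-closure): - technique_class: relative-entropy corrector chapman-enskog contact-closure
- Literature.Barriers.AtomisticToContinuum.BoltzmannHypothesisBarrier: APPLIES to the class
(relative entropy). Evaded in FORM as narrowed by BoltzmannHypothesisBarrierNarrow: no
infinite-volume classification "stationary ⇒ Gibbs", no one-block/two-block estimate, no block
averages — the closure is the algebraic slow/fast split + the first BBGKY equation tested with
Chapman–Enskog functions. NOT evaded in SUBSTANCE: crux LocalMaxwellianInMean is propagation of
local equilibrium in weak time-averaged one-body form (honestly ranked #3 with that why-might-fail);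
the card's resummed-contact-response refinement, which would make local equilibration an output, is
recorded under NOT DECOMPOSED YET. For the barrier's ideal-gas kernel the method correctly has
nothing to invert (no collisions ⇒ no 𝓛♭).
- Literature.Barriers.AtomisticToContinuum.HighMomentumCutoffBarrier: APPLIES (relative entropy with
|v|²/2 and a convected cubic energy current). EVADED as to the printed mechanism
(HighMomentumCutoffBarrierNarrow: the entropy-inequality truncation fails because ∫exp(γ|p|³ −
|p|²/2θ) = ∞): no entropy inequality / large-deviation bound is ever applied to the cubic current —
the kinetic terms are handled linearly (exact slow cancellation + weak BBGKY identity), so only MEAN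
cubic moments are needed (crux CubicMomentsInMean, rank 5) and an entropy bound for bilinear CONTACT
functionals with Gaussian-dominated weig

Novelty grade: new-combination — ROUTE REVIEW (refuter rreview g2, 2026-08-15). Novelty NOT re-searched: grade inherited from card audit (triage-HydrodynamicLimit-1-0: new-combination). Route found CLOSED(retired) 13:41Z for assembly conformance only (Statement = abbrev of Literature..HydrodynamicLimit; fix syntactic). CRUXES 3670- (refuter refuter-rreview-route-AtomisticToContinu-8d156edd-g2-0, 2026-08-15T14:40:24Z; prior: SaintRaymondAIHP2009 doi:10.1016/j.anihpc.2008.01.001; OllaVaradhanYau1993 Thm 1.1; Yau1991; KipnisLandim1999 Ch.7; Funaki-Uchiyama-Yau 1996; Esposito-Marra 1994; VanbeijerenErnst1973; Resibois1978; arXiv:1310.0406 (all inherited from card audit))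

History (route lifecycle, newest last):
- 2026-08-15T13:41:17Z · CLOSED retired — not-a-thesis: assembly does not conclude the sub-problem Statement (operator:999:1257524)

sub-problem: HydrodynamicLimit · status: closed(retired) · opened planner-plancard-AtomisticToContinuum-Hydrody-96aa976c-0 2026-08-15T11:22:01Z · rev 0 · ledger route-AtomisticToContinuum-ChapmanEnskogCorrector
GENERATED by the gate from the ledger (D-0016/17). Provers cite these decls: `theorem foo : Summit.AtomisticToContinuum.HydrodynamicLimit.Theses.ChapmanEnskogCorrector.<Decl> := …` in Summits/AtomisticToContinuum/HydrodynamicLimit/Theorems/<Name>.lean.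
-/

namespace Summit.AtomisticToContinuum.HydrodynamicLimit.Theses.ChapmanEnskogCorrector

open scoped BigOperators Topology Manifold Classical MeasureTheory ProbabilityTheory Matrix InnerProductSpace ComplexConjugate ContinuousMap
open Filter Set Function TopologicalSpace MeasureTheory

attribute [summit_statement] _root_.HydrodynamicLimit

/-- item stmt-AtomisticToContinuum-0766 · target · rank 0 · open · by planner
[target] X_RE: for all continuous profiles ∃ σ₀ ∀ σ<σ₀ ∀ classical hs-Euler solutions on [0,T) ∀
flows: the initial local Gibbs laws are probability measures and, if their fields converge at t=0,
then ∀ t<T ∃ activity profile a_t such that the reference local Gibbs law (a_t, u_t, θ_t) is a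
probability measure whose empirical density/momentum/energy fields concentrate exponentially (≤ C
e^{-(N+1)/C}) around (ρ,ρu,E)(t), and klDiv(lawAt Φ_N (localGibbs a₀u₀θ₀) t ‖ localGibbs a_t u_t
θ_t)/(N+1) → 0. Yau1991; OllaVaradhanYau1993 Thm 1.1 (with noise). -/
@[route_item "route-AtomisticToContinuum-ChapmanEnskogCorrector"]
def RelEntropyVanishing : Prop :=
  ∀ (a₀ θ₀ : Literature.MathematicalPhysics.KineticTheory.T3 → ℝ) (u₀ : Literature.MathematicalPhysics.KineticTheory.T3 → Literature.MathematicalPhysics.KineticTheory.V3), Continuous a₀ → Continuous θ₀ → Continuous u₀ → (∀ x, 0 < a₀ x) → (∀ x, 0 < θ₀ x) → ∃ σ₀ : ℝ, 0 < σ₀ ∧ ∀ σ : ℝ, 0 < σ → σ < σ₀ → ∀ (T : ℝ) (ρ θ : ℝ → Literature.MathematicalPhysics.KineticTheory.T3 → ℝ) (u : ℝ → Literature.MathematicalPhysics.KineticTheory.T3 → Literature.MathematicalPhysics.KineticTheory.V3), Literature.MathematicalPhysics.KineticTheory.IsHardSphereEulerSolution σ T ρ u θ → ∀ Φ : (N :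 ℕ) → Literature.Analysis.FluidPDE.HardSphereFlow (Literature.Analysis.FluidPDE.Torus.geometry (Fin 3)) (Literature.MathematicalPhysics.KineticTheory.hsDiameter σ N) (N + 1), (∀ N, MeasureTheory.IsProbabilityMeasure (Literature.MathematicalPhysics.KineticTheory.localGibbsLaw σ a₀ u₀ θ₀ N (Φ N))) ∧ (Literature.MathematicalPhysics.KineticTheory.TendstoHydroFieldsAt (fun N => Literature.MathematicalPhysics.KineticTheory.localGibbsLaw σ a₀ u₀ θ₀ N (Φ N)) Φ ρ u θ 0 → ∀ t ∈ Set.Ico 0 T, ∃ a : Literature.MathematicalPhysics.KineticTheory.T3 → ℝ, (∀ N, MeasureTheory.IsProbabilityMeasure (Literature.MathematicalPhysics.KineticTheory.localGibbsLaw σ a (u t) (θ t) N (Φ N))) ∧ (∀ χ : Literature.MathematicalPhysics.KineticTheory.T3 → ℝ, Continuous χ → ∀ δ : ℝ, 0 < δ → ∃ C : ℝ, 0 < C ∧ ∀ N : ℕ, Literature.MathematicalPhysics.KineticTheory.localGibbsLaw σ a (u t) (θ t) N (Φ N) {z | δ < |Literature.MathematicalPhysics.KineticTheory.empiricalDensityField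 z χ - ∫ x, χ x * ρ t x|} ≤ ENNReal.ofReal (C * Real.exp (-(C⁻¹ * (N + 1)))) ∧ Literature.MathematicalPhysics.KineticTheory.localGibbsLaw σ a (u t) (θ t) N (Φ N) {z | δ < ‖Literature.MathematicalPhysics.KineticTheory.empiricalMomentumField z χ - ∫ x, (χ x * ρ t x) • u t x‖} ≤ ENNReal.ofReal (C * Real.exp (-(C⁻¹ * (N + 1)))) ∧ Literature.MathematicalPhysics.KineticTheory.localGibbsLaw σ a (u t) (θ t) N (Φ N) {z | δ < |Literature.MathematicalPhysics.KineticTheory.empiricalEnergyField z χ - ∫ x, χ x * Literature.MathematicalPhysics.KineticTheory.totalEnergyDensity (ρ t x) (u t x) (θ t x)|} ≤ ENNReal.ofReal (C * Real.exp (-(C⁻¹ * (N + 1))))) ∧ Filter.Tendsto (fun N : ℕ => InformationTheory.klDiv ((Φ N).lawAt (Literature.MathematicalPhysics.KineticTheory.localGibbsLaw σ a₀ u₀ θ₀ N (Φ N)) t) (Literature.MathematicalPhysics.KineticTheory.localGibbsLaw σ a (u t) (θ t) N (Φ N)) / ((N : ENNReal) + 1)) Filter.atTop (nhds 0))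

/-- item stmt-AtomisticToContinuum-3670 · crux · rank 2 · closed · moot by None · by planner
why it might fail: At fixed φ=ρσ³ pre-collisional contact correlations are real (ring/recollision events, Cohen1967 §4c-d, Dorfman1999 §16); Enskog's Y·f⊗f closure is exact only in equilibrium and 'cannot be derived from the Liouville formalism' (Soto2016 p122); only its time-averaged mean is claimed.
sources: VanbeijerenErnst1973, Resibois1978, Cohen1967 §4c-d, Dorfman1999 §16, Soto2016 p122, CIPDiluteGases1994 §4.3 (BBGKY weak form)
[crux] ENSKOG COLLISIONAL TRANSFER IN THE MEAN (trace-free). Along the hard-sphere evolution (N+1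
spheres of diameter ε_N = σ(N+1)^{-1/3} on 𝕋³, local Gibbs data (a₀,u₀,θ₀), σ < σ₀(profiles),
classical hs-Euler solution (ρ,u,θ) on [0,T) with matching initial fields, jointly measurable flow,
t < T): for all smooth coefficient fields c₄ : ℝ×𝕋³→ℝ, c : ℝ×𝕋³→ℝ³ and φ(s,x,v) = c·v + c₄|v|² (a
v-independent c₀(s,x) has zero collisional jump and is omitted), the expected total COLLISIONAL
change of (N+1)⁻¹Σ_i φ(s,z_i) over [0,t] — Jump_N := E[avg φ(t)] − E[avg φ(0)] − ∫_0^t E[avg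
(∂_s+v·∇ₓ)φ(s)] ds, no trace on the collision boundary — minus its Enskog value Ens_N := ∫_0^t ∫
φ(s,y)·(bbgkyCollisionOp G ε_N N 1 0 [clos_s F¹_N(s)])(y) dy ds tends to 0 as N → ∞, where F¹_N(s) =
one-body marginal (nthMarginal) of the transported canonical density, clos_s f (z₀,z₁) =
Y(σ³ρ_s(midpoint))·f(z₀)f(z₁), Y(η) = (hsCompressibility η − 1)/((2π/3)η) (contact value of the pair
correlation by the virial theorem), Y(0)=1. Content: momentum/energy transfer across contacts (the
part of the flux that makes p = ρθZ) equals in the mean what molecular chaos at incoming contact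
with the equilibrium contact factor p -/
@[route_item "route-AtomisticToContinuum-ChapmanEnskogCorrector"]
def EnskogTransferInMean : Prop :=
  ∀ (a₀ θ₀ : Literature.MathematicalPhysics.KineticTheory.T3 → ℝ) (u₀ : Literature.MathematicalPhysics.KineticTheory.T3 → Literature.MathematicalPhysics.KineticTheory.V3), Continuous a₀ → Continuous θ₀ → Continuous u₀ → (∀ x, 0 < a₀ x) → (∀ x, 0 < θ₀ x) → ∃ σ₀ : ℝ, 0 < σ₀ ∧ ∀ σ : ℝ, 0 < σ → σ < σ₀ → ∀ (T : ℝ) (ρ θ : ℝ → Literature.MathematicalPhysics.KineticTheory.T3 → ℝ) (u : ℝ → Literature.MathematicalPhysics.KineticTheory.T3 → Literature.MathematicalPhysics.KineticTheory.V3), Literature.MathematicalPhysics.KineticTheory.IsHardSphereEulerSolution σ T ρ u θ → ∀ Φ : (N : ℕ) → Literature.Analysis.FluidPDE.HardSphereFlow (Literature.Analysis.FluidPDE.Torus.geometry (Fin 3)) (Literature.MathematicalPhysics.KineticTheory.hsDiameter σ N) (N + 1), (∀ N, Measurable (fun p : ℝ × Literature.Analysis.FluidPDE.Config (N + 1) (Fin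 3) Literature.MathematicalPhysics.KineticTheory.T3 => (Φ N).flow p.1 p.2)) → Literature.MathematicalPhysics.KineticTheory.TendstoHydroFieldsAt (fun N => Literature.MathematicalPhysics.KineticTheory.localGibbsLaw σ a₀ u₀ θ₀ N (Φ N)) Φ ρ u θ 0 → ∀ t ∈ Set.Ico 0 T, ∀ (c₄ : ℝ → Literature.MathematicalPhysics.KineticTheory.T3 → ℝ) (c : ℝ → Literature.MathematicalPhysics.KineticTheory.T3 → Literature.MathematicalPhysics.KineticTheory.V3), Literature.Analysis.FunctionSpaces.Torus.IsSmoothSpaceTimeOn Set.univ c₄ → Literature.Analysis.FunctionSpaces.Torus.IsSmoothSpaceTimeOn Set.univ c → let G : Literature.Analysis.FluidPDE.Geometry (Fin 3) Literature.MathematicalPhysics.KineticTheory.T3 := Literature.Analysis.FluidPDE.Torus.geometry (Fin 3); let ε : ℕ → ℝ := fun N => Literature.MathematicalPhysics.KineticTheory.hsDiameter σ N; let P : (N : ℕ) → MeasureTheory.Measure (Literature.Analysis.FluidPDE.Config (N + 1) (Fin 3) Literature.MathematicalPhysics.KineticTheory.T3) := fun N => Literature.MathematicalPhysics.KineticTheory.localGibbsLaw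 σ a₀ u₀ θ₀ N (Φ N); let W : (N : ℕ) → ℝ → Literature.Analysis.FluidPDE.Config (N + 1) (Fin 3) Literature.MathematicalPhysics.KineticTheory.T3 → ℝ := fun N s => (Literature.Analysis.FluidPDE.hardSphereDomain G (N + 1) (ε N)).indicator (Literature.Analysis.FluidPDE.hsTransport (Φ N) s (Literature.Analysis.FluidPDE.canonicalDensity G (ε N) (N + 1) (Literature.MathematicalPhysics.KineticTheory.localGibbsProfile a₀ u₀ θ₀))); let F1 : ℕ → ℝ → Literature.MathematicalPhysics.KineticTheory.T3 × Literature.MathematicalPhysics.KineticTheory.V3 → ℝ := fun N s y => Literature.Analysis.FluidPDE.nthMarginal (N + 1) 1 (W N s) (fun _ => y); let Y : ℝ → ℝ := fun η => if η = 0 then 1 else (Literature.MathematicalPhysics.KineticTheory.hsCompressibility η - 1) / (2 * Real.pi / 3 * η); let clos : ℝ → (Literature.MathematicalPhysics.KineticTheory.T3 × Literature.MathematicalPhysics.KineticTheory.V3 → ℝ) → Literature.Analysis.FluidPDE.Config (2) (Fin 3) Literature.MathematicalPhysics.KineticTheory.T3 → ℝ := fun s f Z => Y (σ ^ 3 * ρ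 s (G.translate (Z 0).1 ((1 / 2 : ℝ) • G.sepVec (Z 1).1 (Z 0).1))) * f (Z 0) * f (Z 1); let φ : ℝ → Literature.MathematicalPhysics.KineticTheory.T3 × Literature.MathematicalPhysics.KineticTheory.V3 → ℝ := fun s y => inner ℝ (c s y.1) y.2 + c₄ s y.1 * ‖y.2‖ ^ 2; let Dφ : ℝ → Literature.MathematicalPhysics.KineticTheory.T3 × Literature.MathematicalPhysics.KineticTheory.V3 → ℝ := fun s y => deriv (fun τ : ℝ => φ (s + τ) (G.translate y.1 (τ • y.2), y.2)) 0; let Jump : ℕ → ℝ := fun N => (∫ z, (∫ y, φ t y ∂(Literature.Analysis.FluidPDE.empiricalMeasure ((Φ N).flow t z))) ∂(P N)) - (∫ z, (∫ y, φ 0 y ∂(Literature.Analysis.FluidPDE.empiricalMeasure z)) ∂(P N)) - ∫ s in (0 : ℝ)..t, (∫ z, (∫ y, Dφ s y ∂(Literature.Analysis.FluidPDE.empiricalMeasure ((Φ N).flow s z))) ∂(P N)); let Ens : ℕ → ℝ := fun N => ∫ s in (0 : ℝ)..t, ∫ y, φ s y * Literature.Analysis.FluidPDE.bbgkyCollisionOp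 G (ε N) (N : ℝ) 1 0 (clos s (F1 N s)) (fun _ => y); Filter.Tendsto (fun N : ℕ => Jump N - Ens N) Filter.atTop (nhds 0)

/-- item stmt-AtomisticToContinuum-3671 · crux · rank 3 · closed · moot by None · by planner
why it might fail: It is propagation of local equilibrium in weak time-averaged one-body form — the Boltzmann-hypothesis input no deterministic interacting dynamics in d≥2 supplies (OllaVaradhanYau1993 §1 p525; Spohn1991 I.3); a persistent non-Maxwellian fast component at fixed σ kills it.
sources: OllaVaradhanYau1993 §1 p525, Spohn1991 Part I Ch. 3, Yau1991, Literature.Barriers.AtomisticToContinuum.BoltzmannHypothesisBarrier, SaintRaymond2009 §6.2.1 p152, CIPDiluteGases1994 §7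
[crux] WEAK LOCAL MAXWELLIANITY OF THE ONE-BODY MARGINAL, TIME-AVERAGED. Same setting: for every
continuous weight φ : ℝ×(𝕋³×ℝ³)→ℝ with |φ(s,x,v)| ≤ 1+|v|², ∫_0^t ∫ φ(s,y)·(hsCollisionTerm G ε_N 1
0 [clos_s F¹_N(s)])(y) dy ds → 0 — the (rate-free, delocalised, Y-weighted) Enskog collision term of
the one-body marginal vanishes weakly in time integral, i.e. F¹_N(s) annihilates the hard-sphere
collision operator asymptotically: it is locally Maxwellian in v in the weak time-averaged sense
(Q(f,f)=0 ⟺ f Maxwellian). This is EXACTLY what the corrector identity consumes: tested with φ = ĝ_s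
= 𝓛♭⁻¹P_fast(∇λ·j) it says the fast driving term of the entropy production equals a bilinear contact
functional + o(1) (the card's 'contact chaos for the corrector weight at precision o(N^{1/3})' is
equivalent to this, because the trace-free jump functional of an O(1) weight is O(1)). In the
Chapman–Enskog picture the left side is O(Kn)+O(ε) = O(N^{-1/3}). [difficulty: open-problem] -/
@[route_item "route-AtomisticToContinuum-ChapmanEnskogCorrector"]
def LocalMaxwellianInMean : Prop :=
  ∀ (a₀ θ₀ : Literature.MathematicalPhysics.KineticTheory.T3 → ℝ) (u₀ : Literature.MathematicalPhysics.KineticTheory.T3 → Literature.MathematicalPhysics.KineticTheory.V3), Continuous a₀ → Continuous θ₀ → Continuous u₀ → (∀ x, 0 < a₀ x) → (∀ x, 0 < θ₀ x) → ∃ σ₀ : ℝ, 0 < σ₀ ∧ ∀ σ : ℝ, 0 < σ → σ < σ₀ → ∀ (T : ℝ) (ρ θ : ℝ → Literature.MathematicalPhysics.KineticTheory.T3 → ℝ) (u : ℝ → Literature.MathematicalPhysics.KineticTheory.T3 → Literature.MathematicalPhysics.KineticTheory.V3), Literature.MathematicalPhysics.KineticTheory.IsHardSphereEulerSolution σ T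 ρ u θ → ∀ Φ : (N : ℕ) → Literature.Analysis.FluidPDE.HardSphereFlow (Literature.Analysis.FluidPDE.Torus.geometry (Fin 3)) (Literature.MathematicalPhysics.KineticTheory.hsDiameter σ N) (N + 1), (∀ N, Measurable (fun p : ℝ × Literature.Analysis.FluidPDE.Config (N + 1) (Fin 3) Literature.MathematicalPhysics.KineticTheory.T3 => (Φ N).flow p.1 p.2)) → Literature.MathematicalPhysics.KineticTheory.TendstoHydroFieldsAt (fun N => Literature.MathematicalPhysics.KineticTheory.localGibbsLaw σ a₀ u₀ θ₀ N (Φ N)) Φ ρ u θ 0 → ∀ t ∈ Set.Ico 0 T, ∀ φ : ℝ → Literature.MathematicalPhysics.KineticTheory.T3 × Literature.MathematicalPhysics.KineticTheory.V3 → ℝ, Continuous (fun p : ℝ × (Literature.MathematicalPhysics.KineticTheory.T3 × Literature.MathematicalPhysics.KineticTheory.V3) => φ p.1 p.2) → (∀ s y, |φ s y| ≤ 1 + ‖y.2‖ ^ 2) → let G : Literature.Analysis.FluidPDE.Geometry (Fin 3) Literature.MathematicalPhysics.KineticTheory.T3 := Literature.Analysis.FluidPDE.Torus.geometry (Fin 3);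 let ε : ℕ → ℝ := fun N => Literature.MathematicalPhysics.KineticTheory.hsDiameter σ N; let W : (N : ℕ) → ℝ → Literature.Analysis.FluidPDE.Config (N + 1) (Fin 3) Literature.MathematicalPhysics.KineticTheory.T3 → ℝ := fun N s => (Literature.Analysis.FluidPDE.hardSphereDomain G (N + 1) (ε N)).indicator (Literature.Analysis.FluidPDE.hsTransport (Φ N) s (Literature.Analysis.FluidPDE.canonicalDensity G (ε N) (N + 1) (Literature.MathematicalPhysics.KineticTheory.localGibbsProfile a₀ u₀ θ₀))); let F1 : ℕ → ℝ → Literature.MathematicalPhysics.KineticTheory.T3 × Literature.MathematicalPhysics.KineticTheory.V3 → ℝ := fun N s y => Literature.Analysis.FluidPDE.nthMarginal (N + 1) 1 (W N s) (fun _ => y); let Y : ℝ → ℝ := fun η => if η = 0 then 1 else (Literature.MathematicalPhysics.KineticTheory.hsCompressibility η - 1) / (2 * Real.pi / 3 * η); let clos : ℝ → (Literature.MathematicalPhysics.KineticTheory.T3 × Literature.MathematicalPhysics.KineticTheory.V3 → ℝ) → Literature.Analysis.FluidPDE.Config (2) (Fin 3) Literature.MathematicalPhysics.KineticTheory.T3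 → ℝ := fun s f Z => Y (σ ^ 3 * ρ s (G.translate (Z 0).1 ((1 / 2 : ℝ) • G.sepVec (Z 1).1 (Z 0).1))) * f (Z 0) * f (Z 1); Filter.Tendsto (fun N : ℕ => ∫ s in (0 : ℝ)..t, ∫ y, φ s y * Literature.Analysis.FluidPDE.hsCollisionTerm G (ε N) 1 0 (clos s (F1 N s)) (fun _ => y)) Filter.atTop (nhds 0)

/-- item stmt-AtomisticToContinuum-3672 · crux · rank 4 · closed · moot by None · by planner
why it might fail: Statically FALSE: prescribed near-contact placements of a vanishing fraction of particles cost o(1) specific entropy yet make the bilinear contact functional of F¹ large; needs ε-scale regularity of F¹ made by the dynamics — the L∞_x bound SaintRaymond2009 §6.2.1 p152 lacks even for Boltzmann.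
sources: SaintRaymond2009 §6.2.1 p152, Yau1991 (entropy inequality), KipnisLandim1999 Ch. 6, LebowitzPenrose1964, Ruelle1969 §4, OllaVaradhanYau1993 §3
[crux] BILINEAR CONTACT FUNCTIONALS OF THE ONE-BODY DEVIATION ARE ENTROPY-CONTROLLED ALONG THE
EVOLUTION. Same setting; for every continuous positive time-dependent activity profile a : ℝ×𝕋³→ℝ
there are C < ∞ and δ_N → 0 with, for all N: Q_N := ∫_0^t σ³ ∫_{𝕋³}∫_{S²}∫∫ (1+|v₁|²+|v|²)|v−v₁|
|δF(x,v₁)| |δF(x+ε_Nω, v)| dv dv₁ dω dx ds ≤ C·(∫_0^t klDiv((Φ_N)_s law ‖ localGibbsLaw σ (a s) (u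
s) (θ s))ds)/(N+1) + δ_N, δF = F¹_N(s) − ρ_s·localMaxwellian 1 θ_s u_s (all in ℝ≥0∞, lintegrals:
junk-safe). This is the quadratic remainder of the corrected entropy balance: the only term
quadratic in F¹ − M is the Enskog closure term tested against the O(ε) jump of ℓ_s and the O(Kn)
corrector ĝ (total weight degree 3, prefactor Nε³ = σ³), and Gronwall needs it ≲ H/N. Expected
proof: OneBodyGaussianBound (support) + (x log x ≥ c(x−1)² on bounded ratios) + LD rate of the
one-body empirical measure under the hard-core local Gibbs law ≥ (1 − Cσ³)·relative entropy (cluster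
expansion, LocalGibbsConcentration technology). [deps: OneBodyGaussianBound,
LocalGibbsConcentration] [difficulty: open-problem] -/
@[route_item "route-AtomisticToContinuum-ChapmanEnskogCorrector"]
def ContactBilinearEntropyBound : Prop :=
  ∀ (a₀ θ₀ : Literature.MathematicalPhysics.KineticTheory.T3 → ℝ) (u₀ : Literature.MathematicalPhysics.KineticTheory.T3 → Literature.MathematicalPhysics.KineticTheory.V3), Continuous a₀ → Continuous θ₀ → Continuous u₀ → (∀ x, 0 < a₀ x) → (∀ x, 0 < θ₀ x) → ∃ σ₀ : ℝ, 0 < σ₀ ∧ ∀ σ : ℝ, 0 < σ → σ < σ₀ → ∀ (T : ℝ) (ρ θ : ℝ → Literature.MathematicalPhysics.KineticTheory.T3 → ℝ) (u : ℝ → Literature.MathematicalPhysics.KineticTheory.T3 → Literature.MathematicalPhysics.KineticTheory.V3), Literature.MathematicalPhysics.KineticTheory.IsHardSphereEulerSolution σ T ρ u θ → ∀ Φ : (N : ℕ) → Literature.Analysis.FluidPDE.HardSphereFlow (Literature.Analysis.FluidPDE.Torus.geometry (Fin 3)) (Literature.MathematicalPhysics.KineticTheory.hsDiameter σ N) (N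 + 1), (∀ N, Measurable (fun p : ℝ × Literature.Analysis.FluidPDE.Config (N + 1) (Fin 3) Literature.MathematicalPhysics.KineticTheory.T3 => (Φ N).flow p.1 p.2)) → Literature.MathematicalPhysics.KineticTheory.TendstoHydroFieldsAt (fun N => Literature.MathematicalPhysics.KineticTheory.localGibbsLaw σ a₀ u₀ θ₀ N (Φ N)) Φ ρ u θ 0 → ∀ t ∈ Set.Ico 0 T, ∀ a : ℝ → Literature.MathematicalPhysics.KineticTheory.T3 → ℝ, Continuous (fun p : ℝ × Literature.MathematicalPhysics.KineticTheory.T3 => a p.1 p.2) → (∀ s x, 0 < a s x) → let G : Literature.Analysis.FluidPDE.Geometry (Fin 3) Literature.MathematicalPhysics.KineticTheory.T3 := Literature.Analysis.FluidPDE.Torus.geometry (Fin 3); let ε : ℕ → ℝ := fun N => Literature.MathematicalPhysics.KineticTheory.hsDiameter σ N; let P : (N : ℕ) → MeasureTheory.Measure (Literature.Analysis.FluidPDE.Config (N + 1) (Fin 3) Literature.MathematicalPhysics.KineticTheory.T3) := fun N => Literature.MathematicalPhysics.KineticTheory.localGibbsLaw σ a₀ u₀ θ₀ N (Φ N); let W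 : (N : ℕ) → ℝ → Literature.Analysis.FluidPDE.Config (N + 1) (Fin 3) Literature.MathematicalPhysics.KineticTheory.T3 → ℝ := fun N s => (Literature.Analysis.FluidPDE.hardSphereDomain G (N + 1) (ε N)).indicator (Literature.Analysis.FluidPDE.hsTransport (Φ N) s (Literature.Analysis.FluidPDE.canonicalDensity G (ε N) (N + 1) (Literature.MathematicalPhysics.KineticTheory.localGibbsProfile a₀ u₀ θ₀))); let F1 : ℕ → ℝ → Literature.MathematicalPhysics.KineticTheory.T3 × Literature.MathematicalPhysics.KineticTheory.V3 → ℝ := fun N s y => Literature.Analysis.FluidPDE.nthMarginal (N + 1) 1 (W N s) (fun _ => y); let M : ℝ → Literature.MathematicalPhysics.KineticTheory.T3 × Literature.MathematicalPhysics.KineticTheory.V3 → ℝ := fun s y => ρ s y.1 * Literature.Analysis.FluidPDE.localMaxwellian 1 (θ s y.1) (u s y.1) y.2; let Q : ℕ → ENNReal := fun N => ∫⁻ s in Set.Ioo 0 t, ∫⁻ x : Literature.MathematicalPhysics.KineticTheory.T3, ∫⁻ ω : Metric.sphere (0 : Literature.MathematicalPhysics.KineticTheory.V3) 1, (∫⁻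 v₁ : Literature.MathematicalPhysics.KineticTheory.V3, ∫⁻ v : Literature.MathematicalPhysics.KineticTheory.V3, ENNReal.ofReal (σ ^ 3 * ((1 + ‖v₁‖ ^ 2 + ‖v‖ ^ 2) * ‖v - v₁‖ * |F1 N s (x, v₁) - M s (x, v₁)| * |F1 N s (G.translate x (ε N • (ω : Literature.MathematicalPhysics.KineticTheory.V3)), v) - M s (G.translate x (ε N • (ω : Literature.MathematicalPhysics.KineticTheory.V3)), v)|))) ∂Literature.MathematicalPhysics.KineticTheory.sphereMeasure; ∃ C : NNReal, ∃ δ : ℕ → ENNReal, Filter.Tendsto δ Filter.atTop (nhds 0) ∧ ∀ N : ℕ, Q N ≤ (C : ENNReal) * (∫⁻ s in Set.Ioo 0 t, InformationTheory.klDiv ((Φ N).lawAt (P N) s) (Literature.MathematicalPhysics.KineticTheory.localGibbsLaw σ (a s) (u s) (θ s) N (Φ N))) / ((N : ENNReal) + 1) + δ N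

/-- item stmt-AtomisticToContinuum-3673 · crux · rank 5 · closed · moot by None · by planner
why it might fail: Energy conservation bounds only quadratic moments; entropy w.r.t. the invariant Gibbs state gives nothing above |v|² (Gaussian MGF); a fraction N^{-a} of particles at speeds N^{a/2} is energetically and entropically admissible and makes the mean cubic moment diverge.
sources: OllaVaradhanYau1993 §1 p525, Literature.Barriers.AtomisticToContinuum.HighMomentumCutoffBarrier, SaintRaymond2009 §6.2.1 p152, Spohn1991 Part I Ch. 3
[crux] MEAN CUBIC VELOCITY MOMENTS ALONG THE EVOLUTION. Same setting: ∃ C, N₀ with ∫ (N+1)⁻¹Σ_i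
|v_i(s)|³ dP₀ ≤ C (as a lintegral of the flowed configuration under the initial local Gibbs law) for
all N ≥ N₀ and s ∈ [0,t]. The polynomial, in-the-mean shadow of LargeVelocityControl (stmt-0781,
informal, exponential moments — infinite already at t = 0): in this route the cubic energy current
is never put through an entropy inequality, so only the O(Kn) streaming terms (∂_s+v·∇)ĝ ~ |v|³ of
the Chapman–Enskog test function need it. Implied by OneBodyGaussianBound (support
OneBodyGaussianBoundGivesMoments). [difficulty: L] -/
@[route_item "route-AtomisticToContinuum-ChapmanEnskogCorrector"]
def CubicMomentsInMean : Prop :=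
  ∀ (a₀ θ₀ : Literature.MathematicalPhysics.KineticTheory.T3 → ℝ) (u₀ : Literature.MathematicalPhysics.KineticTheory.T3 → Literature.MathematicalPhysics.KineticTheory.V3), Continuous a₀ → Continuous θ₀ → Continuous u₀ → (∀ x, 0 < a₀ x) → (∀ x, 0 < θ₀ x) → ∃ σ₀ : ℝ, 0 < σ₀ ∧ ∀ σ : ℝ, 0 < σ → σ < σ₀ → ∀ (T : ℝ) (ρ θ : ℝ → Literature.MathematicalPhysics.KineticTheory.T3 → ℝ) (u : ℝ → Literature.MathematicalPhysics.KineticTheory.T3 → Literature.MathematicalPhysics.KineticTheory.V3), Literature.MathematicalPhysics.KineticTheory.IsHardSphereEulerSolution σ T ρ u θ → ∀ Φ : (N : ℕ) → Literature.Analysis.FluidPDE.HardSphereFlow (Literature.Analysis.FluidPDE.Torus.geometry (Fin 3)) (Literature.MathematicalPhysics.KineticTheory.hsDiameter σ N) (N + 1), (∀ N, Measurable (fun p : ℝ × Literature.Analysis.FluidPDE.Config (N + 1) (Fin 3) Literature.MathematicalPhysics.KineticTheory.T3 => (Φ N).flow p.1 p.2)) → Literature.MathematicalPhysics.KineticTheory.TendstoHydroFieldsAt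 (fun N => Literature.MathematicalPhysics.KineticTheory.localGibbsLaw σ a₀ u₀ θ₀ N (Φ N)) Φ ρ u θ 0 → ∀ t ∈ Set.Ico 0 T, let P : (N : ℕ) → MeasureTheory.Measure (Literature.Analysis.FluidPDE.Config (N + 1) (Fin 3) Literature.MathematicalPhysics.KineticTheory.T3) := fun N => Literature.MathematicalPhysics.KineticTheory.localGibbsLaw σ a₀ u₀ θ₀ N (Φ N); ∃ C : NNReal, ∃ N₀ : ℕ, ∀ N, N₀ ≤ N → ∀ s ∈ Set.Icc 0 t, ∫⁻ z, ENNReal.ofReal (∫ y, ‖y.2‖ ^ 3 ∂(Literature.Analysis.FluidPDE.empiricalMeasure ((Φ N).flow s z))) ∂(P N) ≤ (C : ENNReal)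

/-- item stmt-AtomisticToContinuum-0767 · support · rank 9 · closed · moot by None · by planner
sources: Ruelle1969 Ch. 4, LebowitzPenrose1964
[support] Exponential law of large numbers for canonical local Gibbs states of N+1 hard spheres of
diameter σ(N+1)^{-1/3} on 𝕋³: for continuous a, θ₀ > 0, u₀, ∃ σ₀ ∀ σ<σ₀ ∃ continuous ρ₀ > 0
(equilibrium density profile at activity a) with the laws probability measures for all N and
P(|field − limit| > δ) ≤ C e^{-(N+1)/C} for the three fields, C = C(χ, δ) uniform in N and in the
flow. Low-density cluster expansion (Ruelle1969 Ch. 4, LebowitzPenrose1964) + Gaussian velocities.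
Strengthens Literature fact localGibbs_lln. -/
@[route_item "route-AtomisticToContinuum-ChapmanEnskogCorrector"]
def LocalGibbsConcentration : Prop :=
  ∀ (a θ₀ : Literature.MathematicalPhysics.KineticTheory.T3 → ℝ) (u₀ : Literature.MathematicalPhysics.KineticTheory.T3 → Literature.MathematicalPhysics.KineticTheory.V3), Continuous a → Continuous θ₀ → Continuous u₀ → (∀ x, 0 < a x) → (∀ x, 0 < θ₀ x) → ∃ σ₀ : ℝ, 0 < σ₀ ∧ ∀ σ : ℝ, 0 < σ → σ < σ₀ → ∃ ρ₀ : Literature.MathematicalPhysics.KineticTheory.T3 → ℝ, Continuous ρ₀ ∧ (∀ x, 0 < ρ₀ x) ∧ (∀ (N : ℕ) (Φ : Literature.Analysis.FluidPDE.HardSphereFlow (Literature.Analysis.FluidPDE.Torus.geometry (Fin 3)) (Literature.MathematicalPhysics.KineticTheory.hsDiameter σ N) (N + 1)), MeasureTheory.IsProbabilityMeasure (Literature.MathematicalPhysics.KineticTheory.localGibbsLaw σ a u₀ θ₀ N Φ)) ∧ ∀ χ : Literature.MathematicalPhysics.KineticTheory.T3 → ℝ, Continuous χ → ∀ δ : ℝ,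 0 < δ → ∃ C : ℝ, 0 < C ∧ ∀ (N : ℕ) (Φ : Literature.Analysis.FluidPDE.HardSphereFlow (Literature.Analysis.FluidPDE.Torus.geometry (Fin 3)) (Literature.MathematicalPhysics.KineticTheory.hsDiameter σ N) (N + 1)), Literature.MathematicalPhysics.KineticTheory.localGibbsLaw σ a u₀ θ₀ N Φ {z | δ < |Literature.MathematicalPhysics.KineticTheory.empiricalDensityField z χ - ∫ x, χ x * ρ₀ x|} ≤ ENNReal.ofReal (C * Real.exp (-(C⁻¹ * (N + 1)))) ∧ Literature.MathematicalPhysics.KineticTheory.localGibbsLaw σ a u₀ θ₀ N Φ {z | δ < ‖Literature.MathematicalPhysics.KineticTheory.empiricalMomentumField z χ - ∫ x, (χ x * ρ₀ x) • u₀ x‖} ≤ ENNReal.ofReal (C * Real.exp (-(C⁻¹ * (N + 1)))) ∧ Literature.MathematicalPhysics.KineticTheory.localGibbsLaw σ a u₀ θ₀ N Φ {z | δ < |Literature.MathematicalPhysics.KineticTheory.empiricalEnergyField z χ - ∫ x, χ x * Literature.MathematicalPhysics.KineticTheory.totalEnergyDensity (ρ₀ x) (u₀ x) (θ₀ x)|}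 ≤ ENNReal.ofReal (C * Real.exp (-(C⁻¹ * (N + 1))))

/-- item stmt-AtomisticToContinuum-0768 · support · rank 9 · open · by planner
sources: Ruelle1969 §3.4, LebowitzPenrose1964
[support] Hard-sphere equation of state at low density: ∃ η₀ > 0 and F real-analytic on (−η₀, η₀)
with hsExcessFreeEnergy = F on [0, η₀), F(0) = 0, F'(0) = 2π/3 (second virial coefficient of
unit-diameter spheres), and the canonical thermodynamic limit −N⁻¹ log hsFreeVolume η N → F(η)
exists (not just limsup) for η ∈ [0, η₀). Ruelle1969 §3.4 (existence), LebowitzPenrose1964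
(convergence of the virial expansion ⇒ analyticity). Makes hsCompressibility/hsPressure smooth and
Z(η) = 1 + (2π/3)η + O(η²); needed by every route (hyperbolicity of the Euler system, virial
theorem). -/
@[route_item "route-AtomisticToContinuum-ChapmanEnskogCorrector"]
def HsEosLowDensity : Prop :=
  ∃ η₀ : ℝ, 0 < η₀ ∧ ∃ F : ℝ → ℝ, AnalyticOnNhd ℝ F (Set.Ioo (-η₀) η₀) ∧ Set.EqOn Literature.MathematicalPhysics.KineticTheory.hsExcessFreeEnergy F (Set.Ico 0 η₀) ∧ F 0 = 0 ∧ deriv F 0 = 2 * Real.pi / 3 ∧ ∀ η ∈ Set.Ico 0 η₀, Filter.Tendsto (fun N : ℕ => -(N : ℝ)⁻¹ * Real.log (Literature.MathematicalPhysics.KineticTheory.hsFreeVolume η N)) Filter.atTop (nhds (F η))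

/-- item stmt-AtomisticToContinuum-0769 · support · rank 9 · open · by planner
sources: Yau1991, KipnisLandim1999 App. 1 §8
[assembly] X_RE → HydrodynamicLimit: entropy inequality μ(A) ≤ (log 2 + H(μ|λ))/log(1 + 1/λ(A))
(from Donsker–Varadhan / Mathlib klDiv API) with λ(A) ≤ C e^{-(N+1)/C} and H = o(N) gives μ(A) → 0;
μ = lawAt (Φ N) P t = P.map (flow t) turns μ{z | δ < |field z − ·|} into P{z | δ < |field (flow t z)
− ·|} (measurable_flow); the reference concentration is stated for z itself and TendstoHydroFieldsAt
at time 0 of the reference law is not needed. Zero-mass case impossible by the IsProbabilityMeasure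
clauses; take σ₀ from X_RE. -/
@[route_item "route-AtomisticToContinuum-ChapmanEnskogCorrector"]
def EntropyInequalityStep : Prop :=
  RelEntropyVanishing → Literature.MathematicalPhysics.KineticTheory.HydrodynamicLimit

/-- item stmt-AtomisticToContinuum-3674 · support · rank 9 · closed · moot by None · by planner
sources: GST2013, Literature.Barriers.AtomisticToContinuum.HighMomentumCutoffBarrier, SaintRaymond2009 §6.2.1
[support] GAUSSIAN UPPER BOUND ON THE ONE-BODY MARGINAL (sufficient condition for CubicMomentsInMean
and, with the marginal LD rate, for ContactBilinearEntropyBound): same setting, ∃ K, c > 0, N₀: for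
N ≥ N₀, s ∈ [0,t], F¹_N(s)(x,v) ≤ K·exp(−c|v|²) for a.e. (x,v). Lanford-type Gaussian domination is
known only short-time at Boltzmann–Grad (GST2013 Thm); at fixed σ nothing — a mean one-body analogue
of Nachtergaele–Yau's cutoff II.1. Why it might fail: no maximum principle for marginals of a
deterministic flow; Chapman–Enskog corrections grow polynomially in v (so c < 1/(2 max θ) is
essential). -/
@[route_item "route-AtomisticToContinuum-ChapmanEnskogCorrector"]
def OneBodyGaussianBound : Prop :=
  ∀ (a₀ θ₀ : Literature.MathematicalPhysics.KineticTheory.T3 → ℝ) (u₀ : Literature.MathematicalPhysics.KineticTheory.T3 → Literature.MathematicalPhysics.KineticTheory.V3), Continuous a₀ → Continuous θ₀ → Continuous u₀ → (∀ x, 0 < a₀ x) → (∀ x, 0 < θ₀ x) → ∃ σ₀ : ℝ, 0 < σ₀ ∧ ∀ σ : ℝ, 0 < σ → σ < σ₀ → ∀ (T : ℝ) (ρ θ : ℝ → Literature.MathematicalPhysics.KineticTheory.T3 → ℝ) (u : ℝ → Literature.MathematicalPhysics.KineticTheory.T3 → Literature.MathematicalPhysics.KineticTheory.V3), Literature.MathematicalPhysics.KineticTheory.IsHardSphereEulerSolution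 σ T ρ u θ → ∀ Φ : (N : ℕ) → Literature.Analysis.FluidPDE.HardSphereFlow (Literature.Analysis.FluidPDE.Torus.geometry (Fin 3)) (Literature.MathematicalPhysics.KineticTheory.hsDiameter σ N) (N + 1), (∀ N, Measurable (fun p : ℝ × Literature.Analysis.FluidPDE.Config (N + 1) (Fin 3) Literature.MathematicalPhysics.KineticTheory.T3 => (Φ N).flow p.1 p.2)) → Literature.MathematicalPhysics.KineticTheory.TendstoHydroFieldsAt (fun N => Literature.MathematicalPhysics.KineticTheory.localGibbsLaw σ a₀ u₀ θ₀ N (Φ N)) Φ ρ u θ 0 → ∀ t ∈ Set.Ico 0 T, let G : Literature.Analysis.FluidPDE.Geometry (Fin 3) Literature.MathematicalPhysics.KineticTheory.T3 := Literature.Analysis.FluidPDE.Torus.geometry (Fin 3); let ε : ℕ → ℝ := fun N => Literature.MathematicalPhysics.KineticTheory.hsDiameter σ N; let W : (N : ℕ) → ℝ → Literature.Analysis.FluidPDE.Config (N + 1) (Fin 3) Literature.MathematicalPhysics.KineticTheory.T3 → ℝ := fun N s => (Literature.Analysis.FluidPDE.hardSphereDomain G (N + 1) (ε N)).indicator (Literature.Analysis.FluidPDE.hsTransport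 (Φ N) s (Literature.Analysis.FluidPDE.canonicalDensity G (ε N) (N + 1) (Literature.MathematicalPhysics.KineticTheory.localGibbsProfile a₀ u₀ θ₀))); let F1 : ℕ → ℝ → Literature.MathematicalPhysics.KineticTheory.T3 × Literature.MathematicalPhysics.KineticTheory.V3 → ℝ := fun N s y => Literature.Analysis.FluidPDE.nthMarginal (N + 1) 1 (W N s) (fun _ => y); ∃ Kc : ℝ × ℝ, 0 < Kc.2 ∧ ∃ N₀ : ℕ, ∀ N, N₀ ≤ N → ∀ s ∈ Set.Icc 0 t, ∀ᵐ y : Literature.MathematicalPhysics.KineticTheory.T3 × Literature.MathematicalPhysics.KineticTheory.V3, F1 N s y ≤ Kc.1 * Real.exp (-(Kc.2 * ‖y.2‖ ^ 2))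

/-- item stmt-AtomisticToContinuum-3675 · support · rank 9 · closed · moot by None · by planner
sources: Yau1991, OllaVaradhanYau1993 §3, CIPDiluteGases1994 §7, BarangerMouhot2005 Thm 1.1
[support][glue] THE CORRECTOR ARGUMENT: EnskogTransferInMean → LocalMaxwellianInMean →
ContactBilinearEntropyBound → CubicMomentsInMean → RelEntropyVanishing. Steps (each a --supports
lemma, not an item): (1) wlog jointly measurable flow (HardSphereFlow.flow_eq_ae + a measurable
construction); (2) exact identity H(f_t|ψ_t) − H(f_0|ψ_0) = −(N+1)[Jump_N[ℓ](t) + ∫∫(∂_s+v·∇)ℓ_s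
F¹_N(s)] + log(𝒵_t/𝒵_0), ℓ_s = log a_s + log M_{u_s,θ_s}, a_s = EOS-inverse of ρ_s
(HsEosLowDensity), H(f_0|ψ_0) = 0; (3) #2 replaces Jump_N[ℓ] by Ens_N[ℓ] + o(1); (4) algebraic split
of the kinetic current ∇λ·j(v) = mean + slow + fast in L²(M_s(x)); mean + ∂_s-terms + linearised
Enskog transfer + (N+1)⁻¹∂_s log 𝒵 → 0 by the Euler equations in entropy variables with p = ρθZ
(virial identity) and slow linear terms cancel identically; (5) fast term ⟨P_fast(∇λ·j), F¹−M⟩ =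
ρ²Y⟨𝓛♭ĝ, h⟩ rewritten via #3 tested with φ = ĝ_s = 𝓛♭⁻¹P_fast(∇λ·j) (exists: spectral gap of
hardSphereLinearizedOp on the orthogonal of collisionInvariants,
Literature.Analysis.UnboundedOperators; continuous, growth ≤ C(1+|v|²)) as −Y⟨ĝ, Q(Mh,Mh)⟩ + o(1);
(6) all bilinear contact terms ≤ const·Q_N ≤ C∫H/(N+1) + o(1) by #4; streaming remainders O( -/
@[route_item "route-AtomisticToContinuum-ChapmanEnskogCorrector"]
def CorrectedEntropyGronwall : Prop :=
  EnskogTransferInMean → LocalMaxwellianInMean → ContactBilinearEntropyBound → CubicMomentsInMean → RelEntropyVanishing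

/-- item stmt-AtomisticToContinuum-3676 · support · rank 9 · closed · moot by None · by planner
sources: GST2013 §4.2, Sznitman1991 §I.2
[support] OneBodyGaussianBound → CubicMomentsInMean: ∫(N+1)⁻¹Σ|v_i(s)|³ dP₀ = ∫|v|³ F¹_N(s)
(exchangeability of the canonical law + a.e.-equivariance of the flow, or directly symmetrised
marginal) ≤ K∫|v|³e^{−c|v|²} dv. The only subtlety is identifying the mean empirical cubic moment
with the first marginal of the transported density (lawAt_withDensity, measure preservation).
[difficulty: M] -/
@[route_item "route-AtomisticToContinuum-ChapmanEnskogCorrector"]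
def OneBodyGaussianBoundGivesMoments : Prop :=
  OneBodyGaussianBound → CubicMomentsInMean

/-- item stmt-AtomisticToContinuum-3677 · assembly · rank 1 · closed · moot by None · by planner
[assembly] EnskogTransferInMean → LocalMaxwellianInMean → ContactBilinearEntropyBound →
CubicMomentsInMean → Literature.MathematicalPhysics.KineticTheory.HydrodynamicLimit: compose
CorrectedEntropyGronwall (support, the corrector argument) with EntropyInequalityStep (= 0769).
[difficulty: XL via the glue; trivial given both supports] -/
@[route_item "route-AtomisticToContinuum-ChapmanEnskogCorrector"]
def Assembly : Prop :=
  EnskogTransferInMean → LocalMaxwellianInMean → ContactBilinearEntropyBound → CubicMomentsInMean → Literature.MathematicalPhysics.KineticTheory.HydrodynamicLimit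

end Summit.AtomisticToContinuum.HydrodynamicLimit.Theses.ChapmanEnskogCorrector
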